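import Mathlib
import Literature.Probability.LatticeModels.AnchoredClusterExpansion
import Literature.Probability.LatticeModels.LatticeAnimals
import Literature.Probability.LatticeModels.TriangularLatticeProofs
import Literature.Probability.RandomPlanarGeometry.HexSAW

/-!
# Kotecký–Preiss smallness of the cycle activities of the honeycomb loop gas

Route `SAWMassiveIsingTilt` of `CriticalPhenomena/SAWScalingLimit`; line `registered` of the crux
`CriticalCurveContinuity` (stmt-CriticalPhenomena-7686), cycle 3, sub-goal S-D. The loop-`O(1)` gas
`Σ_{even E ⊆ E(H)} z^{|E|}` on a subgraph `H` of the honeycomb lattice is a subset-polymer gas whose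
polymers are the vertex supports `A` of connected even nonempty edge sets `E ⊆ E(H)`, with activity
`ρ(A) = Σ_{E : supp E = A} z^{|E|}`. We prove the one-site Kotecký–Preiss smallness
`IsSmallActivity ρ (1/2)` for `‖z‖ ≤ y₀ := ((256 e^{3/2})⁻¹)²`, uniformly in `H`:

* a polymer `A = supp E` has `|A| ≤ 2|E|`, and `E` is a subset of the `≤ 3|A|` lattice edges at
  `A`, so `|ρ(A)| ≤ 8^{|A|} ‖z‖^{|A|/2}` and `|ρ(A)| e^{(3/2)|A|} ≤ q^{|A|}`, `q = 8 e^{3/2} √‖z‖ ≤ 1/32`;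
* the polymers through a site `x` with `ρ(A) ≠ 0` are connected through `x` in the honeycomb
  lattice (degree `3`), so by the lattice-animal bound `card_connectedFamily_le` at most `16^k` of
  them have `k` sites, and `Σ_{A ∋ x} |ρ(A)| e^{(3/2)|A|} ≤ Σ_{k ≥ 1} (16 q)^k ≤ 32 q ≤ 1`.
-/

noncomputable section

open Literature.Probability Literature.Probability.LatticeModels
  Literature.Probability.RandomPlanarGeometry
open scoped Classical

namespace Summit.CriticalPhenomena.SAWScalingLimit.Theorems.SAWMassiveIsingTilt

/-- A uniformly `3`-bounded neighbour table of the honeycomb lattice. -/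
theorem loopAct_exists_nbr : ∃ N : HexVertex → Finset HexVertex,
    (∀ u, (N u).card ≤ 3) ∧ ∀ u w, hexGraph.Adj u w → w ∈ N u := by
  have hfin : ∀ u : HexVertex, (hexGraph.neighborSet u).Finite := fun u =>
    Set.finite_of_ncard_ne_zero (by rw [card_neighborSet_hexGraph_holds u]; norm_num)
  refine ⟨fun u => (hfin u).toFinset, fun u => ?_, fun u w h => ?_⟩
  · rw [← Set.ncard_eq_toFinset_card _ (hfin u), card_neighborSet_hexGraph_holds u]
  · rw [Set.Finite.mem_toFinset, SimpleGraph.mem_neighborSet]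
    exact h

/-- The support of an edge set has at most twice as many vertices as there are edges. -/
theorem loopAct_card_supp_le (E : Finset (Sym2 HexVertex)) :
    (E.biUnion Sym2.toFinset).card ≤ 2 * E.card := by
  calc (E.biUnion Sym2.toFinset).card ≤ ∑ e ∈ E, (Sym2.toFinset e).card := Finset.card_biUnion_le
    _ ≤ ∑ _e ∈ E, 2 := Finset.sum_le_sum fun e _ => by
        rw [Sym2.card_toFinset]
        split_ifs <;> norm_num
    _ = 2 * E.card := by rw [Finset.sum_const, smul_eq_mul, mul_comm]

/-- A set of lattice edges consists of lattice edges at its own support. -/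
theorem loopAct_subset_edgesAt {N : HexVertex → Finset HexVertex}
    (hN : ∀ u w, hexGraph.Adj u w → w ∈ N u) {E : Finset (Sym2 HexVertex)}
    (hE : ∀ e ∈ E, e ∈ hexGraph.edgeSet) :
    E ⊆ (E.biUnion Sym2.toFinset).biUnion fun u => (N u).image fun w => s(u, w) := by
  intro e he
  induction e with
  | h u w =>
    have hadj : hexGraph.Adj u w := hE _ he
    exact Finset.mem_biUnion.2 ⟨u, Finset.mem_biUnion.2 ⟨_, he, Sym2.mem_toFinset.2 (Sym2.mem_mk_left u w)⟩,
      Finset.mem_image.2 ⟨w, hN u w hadj, rfl⟩⟩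

/-- **Fibre count**: at most `2^{3|A|} = 8^{|A|}` sets of lattice edges have support `A`. -/
theorem loopAct_card_fibre_le {N : HexVertex → Finset HexVertex} (hN3 : ∀ u, (N u).card ≤ 3)
    (hN : ∀ u w, hexGraph.Adj u w → w ∈ N u) {EH : Finset (Sym2 HexVertex)}
    (hEH : ∀ e ∈ EH, e ∈ hexGraph.edgeSet) (A : Finset HexVertex)
    (F : Finset (Finset (Sym2 HexVertex))) (hF : ∀ E ∈ F, E ⊆ EH ∧ E.biUnion Sym2.toFinset = A) :
    F.card ≤ 2 ^ (3 * A.card) := by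
  have hsub : F ⊆ (A.biUnion fun u => (N u).image fun w => s(u, w)).powerset := by
    intro E hE
    obtain ⟨hEEH, hEA⟩ := hF E hE
    rw [Finset.mem_powerset, ← hEA]
    exact loopAct_subset_edgesAt hN fun e he => hEH e (hEEH he)
  refine (Finset.card_le_card hsub).trans ?_
  rw [Finset.card_powerset]
  refine Nat.pow_le_pow_right two_pos ?_
  calc (A.biUnion fun u => (N u).image fun w => s(u, w)).card
      ≤ ∑ u ∈ A, ((N u).image fun w => s(u, w)).card := Finset.card_biUnion_le
    _ ≤ ∑ _u ∈ A, 3 := Finset.sum_le_sum fun u _ => Finset.card_image_le.trans (hN3 u)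
    _ = 3 * A.card := by rw [Finset.sum_const, smul_eq_mul, mul_comm]

/-- **Pointwise bound**: a sum of `z^{|E|}` over lattice edge sets `E` with support `A` has
`|Σ_E z^{|E|}| e^{(3/2)|A|} ≤ (8 e^{3/2} √‖z‖)^{|A|}` when `‖z‖ ≤ 1`. -/
theorem loopAct_norm_sum_le {EH : Finset (Sym2 HexVertex)} (hEH : ∀ e ∈ EH, e ∈ hexGraph.edgeSet)
    (A : Finset HexVertex) (F : Finset (Finset (Sym2 HexVertex)))
    (hF : ∀ E ∈ F, E ⊆ EH ∧ E.biUnion Sym2.toFinset = A) {z : ℂ} (hz : ‖z‖ ≤ 1) :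
    ‖∑ E ∈ F, z ^ E.card‖ * Real.exp ((1 + 1 / 2) * A.card) ≤
      (8 * Real.exp (3 / 2) * Real.sqrt ‖z‖) ^ A.card := by
  obtain ⟨N, hN3, hN⟩ := loopAct_exists_nbr
  have hs0 : 0 ≤ Real.sqrt ‖z‖ := Real.sqrt_nonneg _
  have hs1 : Real.sqrt ‖z‖ ≤ 1 := Real.sqrt_le_one.mpr hz
  have hFcard : (F.card : ℝ) ≤ 8 ^ A.card := by
    have h := loopAct_card_fibre_le hN3 hN hEH A F hF
    calc (F.card : ℝ) ≤ ((2 ^ (3 * A.card) : ℕ) : ℝ) := by exact_mod_cast h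
      _ = 8 ^ A.card := by push_cast; rw [pow_mul]; norm_num
  have hterm : ∀ E ∈ F, ‖z ^ E.card‖ ≤ Real.sqrt ‖z‖ ^ A.card := by
    intro E hE
    rw [norm_pow]
    have h2 : A.card ≤ 2 * E.card := (hF E hE).2 ▸ loopAct_card_supp_le E
    calc ‖z‖ ^ E.card = Real.sqrt ‖z‖ ^ (2 * E.card) := by
          rw [pow_mul, Real.sq_sqrt (norm_nonneg _)]
      _ ≤ Real.sqrt ‖z‖ ^ A.card := pow_le_pow_of_le_one hs0 hs1 h2
  have hsum : ‖∑ E ∈ F, z ^ E.card‖ ≤ F.card * Real.sqrt ‖z‖ ^ A.card := by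
    refine (norm_sum_le _ _).trans ?_
    have h := Finset.sum_le_card_nsmul F (fun E => ‖z ^ E.card‖) _ hterm
    rwa [nsmul_eq_mul] at h
  have hexp : Real.exp ((1 + 1 / 2) * A.card) = Real.exp (3 / 2) ^ A.card := by
    rw [← Real.exp_nat_mul]; congr 1; ring
  calc ‖∑ E ∈ F, z ^ E.card‖ * Real.exp ((1 + 1 / 2) * A.card)
      ≤ (F.card * Real.sqrt ‖z‖ ^ A.card) * Real.exp ((1 + 1 / 2) * A.card) := by gcongr
    _ ≤ (8 ^ A.card * Real.sqrt ‖z‖ ^ A.card) * Real.exp (3 / 2) ^ A.card := by rw [hexp]; gcongr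
    _ = (8 * Real.exp (3 / 2) * Real.sqrt ‖z‖) ^ A.card := by rw [mul_pow, mul_pow]; ring

/-- **Supports of connected edge sets are lattice-connected**: a walk in the graph spanned by a
set `E` of lattice edges is a chain of lattice steps inside the support of `E`. -/
theorem loopAct_reflTransGen {E : Finset (Sym2 HexVertex)} (hE : ∀ e ∈ E, e ∈ hexGraph.edgeSet)
    {x w : HexVertex} (h : (SimpleGraph.fromEdgeSet (E : Set (Sym2 HexVertex))).Reachable x w) :
    Relation.ReflTransGen (fun a b => hexGraph.Adj a b ∧
      a ∈ E.biUnion Sym2.toFinset ∧ b ∈ E.biUnion Sym2.toFinset) x w := by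
  rw [SimpleGraph.reachable_iff_reflTransGen] at h
  induction h with
  | refl => exact Relation.ReflTransGen.refl
  | tail _ hab ih =>
    rw [SimpleGraph.fromEdgeSet_adj, Finset.mem_coe] at hab
    obtain ⟨hmem, -⟩ := hab
    exact ih.tail ⟨hE _ hmem, Finset.mem_biUnion.2 ⟨_, hmem, Sym2.mem_toFinset.2 (Sym2.mem_mk_left _ _)⟩,
      Finset.mem_biUnion.2 ⟨_, hmem, Sym2.mem_toFinset.2 (Sym2.mem_mk_right _ _)⟩⟩

/-- A polymer with nonzero activity is lattice-connected through each of its sites. -/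
theorem loopAct_conn_of_ne_zero {EH : Finset (Sym2 HexVertex)} (hEH : ∀ e ∈ EH, e ∈ hexGraph.edgeSet)
    (A : Finset HexVertex) (F : Finset (Finset (Sym2 HexVertex)))
    (hF : ∀ E ∈ F, E ⊆ EH ∧ E.biUnion Sym2.toFinset = A ∧ ∀ u ∈ A, ∀ w ∈ A,
      (SimpleGraph.fromEdgeSet ((E : Finset (Sym2 HexVertex)) : Set (Sym2 HexVertex))).Reachable u w)
    {z : ℂ} (hne : ∑ E ∈ F, z ^ E.card ≠ 0) {x : HexVertex} (hx : x ∈ A) :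
    ∀ w ∈ A, Relation.ReflTransGen (fun a b => hexGraph.Adj a b ∧ a ∈ A ∧ b ∈ A) x w := by
  obtain ⟨E, hE, -⟩ := Finset.exists_ne_zero_of_sum_ne_zero hne
  obtain ⟨hEEH, hEA, hreach⟩ := hF E hE
  subst hEA
  exact fun w hw => loopAct_reflTransGen (fun e he => hEH e (hEEH he)) (hreach x hx w hw)

/-- **Entropy bound**: for a finite family of lattice-connected polymers through a site `x` and
`0 ≤ q ≤ 1/32`, `Σ_A q^{|A|} ≤ 32 q` (lattice animals on the honeycomb lattice, degree `3`). -/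
theorem loopAct_entropy {x : HexVertex} {𝒜 : Finset (Finset HexVertex)} (hx : ∀ A ∈ 𝒜, x ∈ A)
    (hconn : ∀ A ∈ 𝒜, ∀ w ∈ A,
      Relation.ReflTransGen (fun a b => hexGraph.Adj a b ∧ a ∈ A ∧ b ∈ A) x w)
    {q : ℝ} (hq0 : 0 ≤ q) (hq : q ≤ 1 / 32) :
    ∑ A ∈ 𝒜, q ^ A.card ≤ 32 * q := by
  obtain ⟨N, hN3, hN⟩ := loopAct_exists_nbr
  rw [Finset.sum_comp (fun k => q ^ k) Finset.card]
  have hcount : ∀ k ∈ 𝒜.image Finset.card,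
      1 ≤ k ∧ ((𝒜.filter fun A => A.card = k).card : ℝ) ≤ 16 ^ k := by
    intro k hk
    obtain ⟨A, hA, rfl⟩ := Finset.mem_image.1 hk
    have h1 : 1 ≤ A.card := Finset.card_pos.2 ⟨x, hx A hA⟩
    refine ⟨h1, ?_⟩
    have h := card_connectedFamily_le (R := hexGraph.Adj) (nbr := N) (fun a b h => h.symm) hN3 hN x
      (A.card - 1) (𝒜.filter fun B => B.card = A.card) (fun S hS => ?_)
    · calc ((𝒜.filter fun B => B.card = A.card).card : ℝ) ≤ (((3 + 1) ^ (2 * (A.card - 1)) : ℕ) : ℝ) := by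
            exact_mod_cast h
        _ ≤ 16 ^ A.card := by
            push_cast
            rw [pow_mul]
            norm_num
            exact pow_le_pow_right₀ (by norm_num) (Nat.sub_le _ _)
    · obtain ⟨hS𝒜, hScard⟩ := Finset.mem_filter.1 hS
      exact ⟨hx S hS𝒜, by omega, hconn S hS𝒜⟩
  obtain ⟨n, hn⟩ := (𝒜.image Finset.card).exists_nat_subset_range
  have hsub : 𝒜.image Finset.card ⊆ Finset.Ico 1 n := fun k hk =>
    Finset.mem_Ico.2 ⟨(hcount k hk).1, Finset.mem_range.1 (hn hk)⟩
  have ht0 : 0 ≤ 16 * q := by positivity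
  have ht1 : 16 * q < 1 := by linarith
  calc ∑ k ∈ 𝒜.image Finset.card, (𝒜.filter fun A => A.card = k).card • q ^ k
      = ∑ k ∈ 𝒜.image Finset.card, ((𝒜.filter fun A => A.card = k).card : ℝ) * q ^ k := by
        simp only [nsmul_eq_mul]
    _ ≤ ∑ k ∈ 𝒜.image Finset.card, (16 * q) ^ k := Finset.sum_le_sum fun k hk => by
        rw [mul_pow]
        exact mul_le_mul_of_nonneg_right (hcount k hk).2 (pow_nonneg hq0 _)
    _ ≤ ∑ k ∈ Finset.Ico 1 n, (16 * q) ^ k :=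
        Finset.sum_le_sum_of_subset_of_nonneg hsub fun k _ _ => pow_nonneg ht0 _
    _ ≤ (16 * q) ^ 1 / (1 - 16 * q) := geom_sum_Ico_le_of_lt_one ht0 ht1
    _ ≤ 32 * q := by
        rw [pow_one, div_le_iff₀ (by linarith)]
        nlinarith

/-- **S-D: one-site Kotecký–Preiss smallness of the cycle activities for `‖z‖ ≤ y₀`.** With
`y₀ = ((256 e^{3/2})⁻¹)²`, the activities `ρ(A) = Σ_{E ⊆ E(H) : supp E = A, E even connected nonempty} z^{|E|}`
of the loop gas on any subgraph `H` of the honeycomb lattice satisfy `IsSmallActivity ρ (1/2)`. -/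
theorem isSmallActivity_loopActivity : ∃ y₀ : ℝ, 0 < y₀ ∧
    ∀ (EH : Finset (Sym2 HexVertex)), (∀ e ∈ EH, e ∈ hexGraph.edgeSet) →
      ∀ z : ℂ, ‖z‖ ≤ y₀ →
        IsSmallActivity
          (fun A : Finset HexVertex => ∑ E ∈ EH.powerset with (E.biUnion Sym2.toFinset = A ∧
              A.Nonempty ∧ (∀ u : HexVertex, Even (E.filter (fun e => u ∈ e)).card) ∧
              ∀ u ∈ A, ∀ w ∈ A,
                (SimpleGraph.fromEdgeSet ((E : Finset (Sym2 HexVertex)) : Set (Sym2 HexVertex))).Reachable u w),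
            z ^ E.card)
          (1 / 2) := by
  have hc0 : 0 < 256 * Real.exp (3 / 2) := by positivity
  refine ⟨((256 * Real.exp (3 / 2))⁻¹) ^ 2, by positivity, fun EH hEH z hz => ⟨?_, one_half_pos, ?_⟩⟩
  · -- the empty polymer carries no activity
    refine Finset.sum_eq_zero fun E hE => ?_
    exact absurd (Finset.mem_filter.1 hE).2.2.1 Finset.not_nonempty_empty
  · intro x 𝒜 h𝒜
    -- the smallness parameter `q = 8 e^{3/2} √‖z‖ ≤ 1/32`
    have hsqrt : Real.sqrt ‖z‖ ≤ (256 * Real.exp (3 / 2))⁻¹ := by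
      rw [← Real.sqrt_sq (inv_pos.2 hc0).le]
      exact Real.sqrt_le_sqrt hz
    have hz1 : ‖z‖ ≤ 1 := by
      refine hz.trans ?_
      rw [inv_pow]
      refine inv_le_one_of_one_le₀ ?_
      nlinarith [Real.add_one_le_exp (3 / 2 : ℝ)]
    have hq0 : 0 ≤ 8 * Real.exp (3 / 2) * Real.sqrt ‖z‖ := by positivity
    have hq : 8 * Real.exp (3 / 2) * Real.sqrt ‖z‖ ≤ 1 / 32 := by
      calc 8 * Real.exp (3 / 2) * Real.sqrt ‖z‖
          ≤ 8 * Real.exp (3 / 2) * (256 * Real.exp (3 / 2))⁻¹ := by gcongr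
        _ = 1 / 32 := by field_simp; ring
    -- drop the polymers with zero activity: the others are lattice-connected through `x`
    refine (Finset.sum_filter_of_ne (s := 𝒜)
      (p := fun A => ∀ w ∈ A, Relation.ReflTransGen (fun a b => hexGraph.Adj a b ∧ a ∈ A ∧ b ∈ A) x w)
      fun A hA hne => ?_).symm.le.trans ?_
    · exact loopAct_conn_of_ne_zero hEH A _
        (fun E hE => ⟨Finset.mem_powerset.1 (Finset.mem_filter.1 hE).1, (Finset.mem_filter.1 hE).2.1,
          (Finset.mem_filter.1 hE).2.2.2.2⟩)
        (norm_ne_zero_iff.1 (left_ne_zero_of_mul hne)) (h𝒜 A hA)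
    · refine (Finset.sum_le_sum (g := fun A => (8 * Real.exp (3 / 2) * Real.sqrt ‖z‖) ^ A.card)
        fun A _ => ?_).trans ?_
      · exact loopAct_norm_sum_le hEH A _
          (fun E hE => ⟨Finset.mem_powerset.1 (Finset.mem_filter.1 hE).1, (Finset.mem_filter.1 hE).2.1⟩) hz1
      · refine (loopAct_entropy (fun A hA => h𝒜 A (Finset.mem_filter.1 hA).1)
          (fun A hA => (Finset.mem_filter.1 hA).2) hq0 hq).trans ?_
        linarith

end Summit.CriticalPhenomena.SAWScalingLimit.Theorems.SAWMassiveIsingTilt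

end
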